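import Summits.ResolutionOfSingularities.ResolutionOfSingularities.Theorems.FrobeniusClosingPatchingRelPerfectDepthTargetsR5H
import Summits.ResolutionOfSingularities.ResolutionOfSingularities.Theorems.FrobeniusClosingPatchingRelPerfectDepthOrderToolkit
import Literature.AlgebraicGeometry.Resolution.CartierDivisorControlledTransform
import HarnessLib

/-!
# `PatchingRelPerfect` (stmt-ResolutionOfSingularities-16161), chain W5.2 — rung R5ᴴ: the weight-one law OFF THE CENTRE
# (`τᶜ(D, 1) = τ^*D` for an effective Cartier divisor missing the centre)

[OURS · L1 W5.2 · res-D-pv-055, owner of R5ᴴ; shared tool for N2 (X-step), N3 (CJS transport on the carrier, res-D-pv-054) and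
N5 (peel, res-type-003)] The E-side law of `HSepSeq` (T-R5H p535426) transports EVERY member by the weight-one controlled
transform `D ↦ τᶜ(D, 1) = (τ^*D : C𝒪)`. For a member that does NOT contain the (connected regular) centre `V(C)` this is the
plain pull-back `τ^*D`: the tree's «strict transform of an effective Cartier divisor = controlled transform with the GENERIC weight»
(`IsBlowup.strictTransformIdeal_eq_controlledTransform`, Kollár 3.30.2) at generic weight `0` (the generic point of `V(C)` is off
`Supp D`), sandwiched between `τ^*D ≤ τᶜ(D, 1) ≤ ⋃ₙ (τ^*D : C𝒪ⁿ)`.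

* `controlledTransform_one_eq_comap_of_idealOrder_eq_zero` — pointed form (generic point `η` of `V(C)`, `ord_η D = 0`);
* `controlledTransform_one_eq_comap_of_not_le` — on a regular scheme with Noetherian space: `V(C)` connected regular lying on SOME
  effective Cartier divisor (e.g. a charged member — the legality clause of `HSepSeq`), `D` effective Cartier with `¬ D ≤ C`;
* `controlledTransform_one_eq_comap_of_support_eq_empty` — the degenerate empty centre (`τ` an isomorphism, `C𝒪 = ⊤`).

Honest framing: OURS (AI-written, weaker than expert review); corollaries of tree theorems; nothing here is a statement of the
manuscript under review.

## Sources
* J. Kollár, *Lectures on Resolution of Singularities* (2007), 3.30.2 (birational transform of a divisor `= τ^*D − mE`). [Kollar2007]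
* E. Bierstone, D. Grigoriev, P. Milman, J. Włodarczyk (2011), §3.2 (controlled transform). [BierstoneGrigorievMilmanWlodarczyk2011]
-/

set_option linter.dupNamespace false -- mandated namespace of this single-conjunct summit

noncomputable section

open CategoryTheory AlgebraicGeometry TopologicalSpace IsLocalRing
open Literature.AlgebraicGeometry.Resolution Scheme.IdealSheafData

namespace Summit.ResolutionOfSingularities.ResolutionOfSingularities.Theorems.DepthTargets

universe u

variable {W W' : Scheme.{u}} {τ : W' ⟶ W} {C D : W.IdealSheafData}

/-- **Off the centre the weight-one law is the pull-back, pointed form**: `W` regular locally Noetherian, `V(C)` a regular closed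
subscheme, nowhere dense, with generic point `η`, `D` an effective Cartier divisor with `ord_η D = 0` (i.e. `η ∉ Supp D`), `τ` the
blowing up along `C`: `τᶜ(D, 1) = τ^*D`. [cite: Kollar2007, 3.30.2] -/
theorem controlledTransform_one_eq_comap_of_idealOrder_eq_zero [IsLocallyNoetherian W] (hW : Scheme.IsRegular W)
    (hC : Scheme.IsRegular C.subscheme) {η : W} (hη : IsGenericPoint η (C.support : Set W))
    (hint : interior (C.support : Set W) = ∅) (hD : IsEffectiveCartier D) (hord : idealOrder D η = 0)
    (hτ : IsBlowup τ C) : controlledTransform τ C D 1 = D.comap τ := by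
  have hst : strictTransformIdeal τ C D = controlledTransform τ C D 0 :=
    hτ.strictTransformIdeal_eq_controlledTransform hW hC hη hint hord hD
  refine le_antisymm ?_ (comap_le_controlledTransform τ C D 1)
  calc controlledTransform τ C D 1 ≤ strictTransformIdeal τ C D := controlledTransform_le_strictTransformIdeal τ C D 1
    _ = D.comap τ := by rw [hst, controlledTransform_zero]

/-- The degenerate case of an EMPTY centre: `C𝒪 = ⊤`, so `τᶜ(D, 1) = τ^*D` for every `D`. [folklore] -/
theorem controlledTransform_one_eq_comap_of_support_eq_empty (hC : (C.support : Set W) = ∅) (D : W.IdealSheafData) :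
    controlledTransform τ C D 1 = D.comap τ := by
  have hCtop : C = ⊤ := by
    rw [← support_eq_bot_iff]; exact Closeds.ext (by rw [hC]; rfl)
  rw [controlledTransform, hCtop, comap_top, pow_one, colon_top]

/-- **Off the centre the weight-one law is the pull-back**: `W` regular with Noetherian underlying space, `V(C)` a CONNECTED regular
closed subscheme lying on some effective Cartier divisor `B` (e.g. the charged member of the legality clause of `HSepSeq`; this makes
`V(C)` nowhere dense), `D` an effective Cartier divisor NOT containing the centre (`¬ D ≤ C`), `τ` the blowing up along `C`:
`τᶜ(D, 1) = τ^*D`. (If `V(C) = ∅` this is the previous lemma; otherwise `V(C)` has a generic point `η`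
(`Scheme.IsRegular.exists_isGenericPoint_support_of_isPreconnected`), `η ∉ Supp D` since `C = 𝓘(V(C))` is radical and `Supp D` is
closed, and Kollár 3.30.2 applies with generic weight `0`.) [cite: Kollar2007, 3.30.2] -/
theorem controlledTransform_one_eq_comap_of_not_le [IsLocallyNoetherian W] [NoetherianSpace W] (hW : Scheme.IsRegular W)
    (hC : Scheme.IsRegular C.subscheme) (hconn : _root_.IsPreconnected (C.support : Set W))
    {B : W.IdealSheafData} (hB : IsEffectiveCartier B) (hCB : (C.support : Set W) ⊆ B.support)
    (hD : IsEffectiveCartier D) (hDC : ¬ D ≤ C) (hτ : IsBlowup τ C) :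
    controlledTransform τ C D 1 = D.comap τ := by
  rcases (C.support : Set W).eq_empty_or_nonempty with hempty | hne
  · exact controlledTransform_one_eq_comap_of_support_eq_empty hempty D
  obtain ⟨η, hη⟩ := Scheme.IsRegular.exists_isGenericPoint_support_of_isPreconnected hC hconn hne
  have hηC : η ∈ (C.support : Set W) := hη.mem
  have hint : interior (C.support : Set W) = ∅ := interior_eq_empty_of_isGenericPoint_of_mem_support hη hB (hCB hηC)
  -- `η ∉ Supp D`: otherwise `V(C) = cl {η} ⊆ Supp D`, i.e. `D ≤ 𝓘(V(C)) = C`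
  have hηD : η ∉ D.support := by
    intro hηD
    apply hDC
    have hsub : (C.support : Set W) ⊆ D.support := (hη.mem_closed_set_iff D.support.isClosed).mp hηD
    rw [eq_vanishingIdeal_support_of_isRegular C hC]
    exact le_support_iff_le_vanishingIdeal.mp hsub
  exact controlledTransform_one_eq_comap_of_idealOrder_eq_zero hW hC hη hint hD
    ((idealOrder_eq_zero_iff_not_mem_support D η).mpr hηD) hτ

/-- **Members containing the centre**: `D ≤ C` iff `V(C) ⊆ Supp D` (the centre being a regular, hence reduced, closed subscheme:
`C = 𝓘(V(C))`). [folklore] -/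
theorem le_centre_iff_support_subset [IsLocallyNoetherian W] (hC : Scheme.IsRegular C.subscheme) :
    D ≤ C ↔ (C.support : Set W) ⊆ D.support := by
  constructor
  · intro h; exact support_antitone h
  · intro h
    rw [eq_vanishingIdeal_support_of_isRegular C hC]
    exact le_support_iff_le_vanishingIdeal.mp h

/-- **Members containing the centre, stalk form** (the membership test of `divisorsOver`): `D ≤ C` iff `D_x ≤ C_x` at every point of
`V(C)` (off `V(C)` the stalk `C_x` is the unit ideal). [folklore] -/
theorem le_centre_iff_forall_stalkIdeal_le :
    D ≤ C ↔ ∀ x ∈ (C.support : Set W), stalkIdeal D x ≤ stalkIdeal C x := by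
  constructor
  · intro h x _; exact stalkIdeal_mono h x
  · intro h
    refine le_of_forall_stalkIdeal_le fun x => ?_
    by_cases hx : x ∈ (C.support : Set W)
    · exact h x hx
    · have htop : stalkIdeal C x = ⊤ := by
        by_contra hne
        exact hx ((mem_support_iff_stalkIdeal_le C x).mpr (IsLocalRing.le_maximalIdeal hne))
      rw [htop]; exact le_top

/-- **The total exponent through the centre is carried by a member over it**: if `1 ≤ weightOf 𝒟 (divisorsOver 𝒟 C V(C))` then some
`(D, a) ∈ 𝒟` has `1 ≤ a` and `D ≤ C` (the legality clause of `HSepSeq` produces a charged member containing the centre). [folklore] -/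
theorem exists_mem_le_centre_of_one_le_weightOf {𝒟 : List (W.IdealSheafData × ℕ)}
    (hw : 1 ≤ weightOf 𝒟 (divisorsOver 𝒟 C C.support)) : ∃ p ∈ 𝒟, 1 ≤ p.2 ∧ p.1 ≤ C := by
  classical
  -- some member contributes a positive exponent
  have key : ∀ (L : List (W.IdealSheafData × ℕ)) (T : Finset W.IdealSheafData), 1 ≤ weightOf L T →
      ∃ p ∈ L, 1 ≤ p.2 ∧ p.1 ∈ T := by
    intro L T
    induction L with
    | nil => intro h; simp at h
    | cons q L ih =>
      intro h
      rw [weightOf_cons] at h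
      by_cases hq : q.1 ∈ T
      · by_cases hq2 : 1 ≤ q.2
        · exact ⟨q, List.mem_cons_self, hq2, hq⟩
        · rw [if_pos hq] at h
          obtain ⟨p, hp, h1, h2⟩ := ih (by omega)
          exact ⟨p, List.mem_cons_of_mem _ hp, h1, h2⟩
      · rw [if_neg hq, zero_add] at h
        obtain ⟨p, hp, h1, h2⟩ := ih h
        exact ⟨p, List.mem_cons_of_mem _ hp, h1, h2⟩
  obtain ⟨p, hp, hp2, hpT⟩ := key 𝒟 _ hw
  refine ⟨p, hp, hp2, ?_⟩
  rw [mem_divisorsOver_iff] at hpT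
  exact le_centre_iff_forall_stalkIdeal_le.mpr hpT.2

end Summit.ResolutionOfSingularities.ResolutionOfSingularities.Theorems.DepthTargets

end
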